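import Summits.RiemannHypothesis.RiemannHypothesis.Theorems.PfPersistenceExpSumVanishing
import HarnessLib

/-!
# Mean-square coefficient bounds for exponential and cosine sums (pub-rhpf, barrier-typer gen 9)

**HONEST FRAMING. This is a long-odds MECHANISM SEARCH; no RH claims.** Pure Mathlib lemmas (no cell objects):
the QUANTITATIVE companion of `PfPersistenceExpSumVanishing`. There, `Σ_j b_j μ_j^n → 0` forced `b = 0`
(Vandermonde); here an eventual BOUND `‖Σ_j b_j μ_j^n‖ ≤ β` forces `Σ_j ‖b_j‖² ≤ β²` (classical mean-value
orthogonality of distinct characters `n ↦ μ_j^n` in Cesàro mean: `Σ_{n<M} ‖g(n)‖² = M Σ_j ‖b_j‖² + O(1)`, the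
`O(1)` coming from bounded geometric sums of the unimodular ratios `μ_j \bar μ_k ≠ 1`). The typer's
vanishing-tube file applies the cosine form to the DIAGONAL entries of an arithmetic deviation at a fixed sampling
height, where the tube radius need not tend to zero in the rank but only be small at large heights.

* `norm_geom_sum_le_of_norm_one` (PROVED): `‖Σ_{n<M} ν^n‖ ≤ 2/‖ν − 1‖` for unimodular `ν ≠ 1`.
* `sum_normSq_le_of_expSum_le` (PROVED): distinct unimodular nodes, eventually `‖Σ_j b_j μ_j^n‖ ≤ β` ⟹
  `Σ_j ‖b_j‖² ≤ β²`; `norm_coeff_le_of_expSum_le`: each `‖b_j‖ ≤ β`.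
* `cosSum_coeff_le` (PROVED): for injective `ω : ι → (0, 2π)` with `ω_k + ω_l ≠ 2π`, if eventually
  `|c₀ + Σ_k c_k cos(m ω_k)| ≤ β` then `|c_k| ≤ 2β` for all `k` and `|c₀| ≤ β`.
-/

set_option linter.dupNamespace false  -- the mandated namespace repeats `RiemannHypothesis`

open Filter Topology Complex Finset
open scoped ComplexConjugate

namespace Summit.RiemannHypothesis.RiemannHypothesis.Theorems.PfPersistence

/-! ## §1 Bounded geometric sums and the mean-square identity -/

/-- PROVED: `‖Σ_{n<M} ν^n‖ ≤ 2 / ‖ν − 1‖` for unimodular `ν ≠ 1`. [folklore] -/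
theorem norm_geom_sum_le_of_norm_one {ν : ℂ} (hν : ‖ν‖ = 1) (h1 : ν ≠ 1) (M : ℕ) :
    ‖∑ n ∈ Finset.range M, ν ^ n‖ ≤ 2 / ‖ν - 1‖ := by
  rw [geom_sum_eq h1, norm_div]
  have hden : 0 < ‖ν - 1‖ := norm_pos_iff.2 (sub_ne_zero.2 h1)
  refine div_le_div_of_nonneg_right ?_ hden.le
  calc ‖ν ^ M - 1‖ ≤ ‖ν ^ M‖ + ‖(1 : ℂ)‖ := norm_sub_le _ _
    _ = 2 := by rw [norm_pow, hν, one_pow, norm_one]; norm_num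

/-- PROVED: for unimodular `μ'`, `μ \bar μ' = 1` forces `μ = μ'`. [folklore] -/
theorem eq_of_mul_conj_eq_one {μ μ' : ℂ} (h' : ‖μ'‖ = 1) (h : μ * conj μ' = 1) : μ = μ' := by
  have hμ' : conj μ' * μ' = 1 := by
    rw [mul_comm, Complex.mul_conj, Complex.normSq_eq_norm_sq, h']; simp
  calc μ = μ * (conj μ' * μ') := by rw [hμ', mul_one]
    _ = μ' := by rw [← mul_assoc, h, one_mul]

/-- PROVED: splitting off the diagonal term of a finite sum. [folklore] -/
theorem sum_eq_add_sum_ite {ι : Type*} [Fintype ι] [DecidableEq ι] (f : ι → ℂ) (j : ι) :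
    ∑ k, f k = f j + ∑ k, (if j = k then 0 else f k) := by
  have h1 : ∑ k, f k = ∑ k, ((if j = k then f k else 0) + (if j = k then 0 else f k)) :=
    Finset.sum_congr rfl fun k _ => by split_ifs <;> simp
  rw [h1, Finset.sum_add_distrib, Finset.sum_ite_eq]
  simp

/-- **PROVED — MEAN-SQUARE COEFFICIENT BOUND.** For pairwise distinct unimodular nodes `μ_j` and coefficients
`b_j`: if eventually `‖Σ_j b_j μ_j^n‖ ≤ β` then `Σ_j ‖b_j‖² ≤ β²`. Proof: `Σ_{n<M} ‖g(n)‖² = M·Σ_j‖b_j‖² + E_M`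
with `‖E_M‖ ≤ C₀` (off-diagonal geometric sums, `norm_geom_sum_le_of_norm_one`), while the hypothesis gives
`Σ_{n<M} ‖g(n)‖² ≤ K₀ + M β²`; let `M → ∞`. [folklore] -/
theorem sum_normSq_le_of_expSum_le {ι : Type*} [Fintype ι] {μ : ι → ℂ} (hμ : Function.Injective μ)
    (hunit : ∀ j, ‖μ j‖ = 1) {b : ι → ℂ} {β : ℝ}
    (h : ∀ᶠ n : ℕ in atTop, ‖∑ j, b j * μ j ^ n‖ ≤ β) : ∑ j, ‖b j‖ ^ 2 ≤ β ^ 2 := by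
  classical
  obtain ⟨n₀, hn₀⟩ := eventually_atTop.1 h
  have hν1 : ∀ j k, ‖μ j * conj (μ k)‖ = 1 := fun j k => by
    rw [norm_mul, Complex.norm_conj, hunit, hunit, one_mul]
  have hνne : ∀ j k, j ≠ k → μ j * conj (μ k) ≠ 1 := fun j k hjk h1 =>
    hjk (hμ (eq_of_mul_conj_eq_one (hunit k) h1))
  -- (1) pointwise expansion of `‖g n‖²`
  have hsq : ∀ n : ℕ, (((‖∑ j, b j * μ j ^ n‖ ^ 2 : ℝ)) : ℂ)
      = ∑ j, ∑ k, b j * conj (b k) * (μ j * conj (μ k)) ^ n := by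
    intro n
    push_cast
    rw [← Complex.mul_conj', map_sum, Finset.sum_mul_sum]
    refine Finset.sum_congr rfl fun j _ => Finset.sum_congr rfl fun k _ => ?_
    rw [map_mul, map_pow]; ring
  -- (2) the summed identity
  have hdiag : ∀ (j : ι) (M : ℕ), b j * conj (b j) * ∑ n ∈ Finset.range M, (μ j * conj (μ j)) ^ n
      = (((‖b j‖ ^ 2 * M : ℝ)) : ℂ) := by
    intro j M
    rw [Complex.mul_conj', Complex.mul_conj', hunit j]
    push_cast
    simp
  have key : ∀ M : ℕ, (((∑ n ∈ Finset.range M, ‖∑ j, b j * μ j ^ n‖ ^ 2 : ℝ)) : ℂ)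
      = (((M * ∑ j, ‖b j‖ ^ 2 : ℝ)) : ℂ) + ∑ j, ∑ k,
          (if j = k then 0 else b j * conj (b k) * ∑ n ∈ Finset.range M, (μ j * conj (μ k)) ^ n) := by
    intro M
    rw [Complex.ofReal_sum, Finset.sum_congr rfl fun n _ => hsq n, Finset.sum_comm]
    have hjk : ∀ j, ∑ n ∈ Finset.range M, ∑ k, b j * conj (b k) * (μ j * conj (μ k)) ^ n
        = ∑ k, b j * conj (b k) * ∑ n ∈ Finset.range M, (μ j * conj (μ k)) ^ n := fun j => by
      rw [Finset.sum_comm]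
      exact Finset.sum_congr rfl fun k _ => by rw [Finset.mul_sum]
    rw [Finset.sum_congr rfl fun j _ => hjk j,
      Finset.sum_congr rfl fun j _ => sum_eq_add_sum_ite (fun k => b j * conj (b k) * _) j,
      Finset.sum_add_distrib, Finset.sum_congr rfl fun j _ => hdiag j M]
    congr 1
    push_cast
    rw [Finset.mul_sum]
    exact Finset.sum_congr rfl fun j _ => by ring
  -- (3) the off-diagonal error is bounded independently of `M`
  set C₀ : ℝ := ∑ j, ∑ k, (if j = k then (0 : ℝ) else ‖b j‖ * ‖b k‖ * (2 / ‖μ j * conj (μ k) - 1‖)) with hC₀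
  have hE : ∀ M : ℕ, ‖∑ j, ∑ k, (if j = k then 0 else
      b j * conj (b k) * ∑ n ∈ Finset.range M, (μ j * conj (μ k)) ^ n)‖ ≤ C₀ := by
    intro M
    refine (norm_sum_le _ _).trans (Finset.sum_le_sum fun j _ =>
      (norm_sum_le _ _).trans (Finset.sum_le_sum fun k _ => ?_))
    by_cases hjk : j = k
    · simp [hjk]
    · rw [if_neg hjk, if_neg hjk, norm_mul, norm_mul, Complex.norm_conj]
      exact mul_le_mul_of_nonneg_left (norm_geom_sum_le_of_norm_one (hν1 j k) (hνne j k hjk) M)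
        (by positivity)
  -- (4) lower bound
  have hlow : ∀ M : ℕ, (M : ℝ) * ∑ j, ‖b j‖ ^ 2 - C₀
      ≤ ∑ n ∈ Finset.range M, ‖∑ j, b j * μ j ^ n‖ ^ 2 := by
    intro M
    have hre := congrArg Complex.re (key M)
    rw [Complex.ofReal_re, Complex.add_re, Complex.ofReal_re] at hre
    have habs := (abs_le.1 ((Complex.abs_re_le_norm _).trans (hE M))).1
    linarith
  -- (5) upper bound
  set K₀ : ℝ := ∑ n ∈ Finset.range n₀, ‖∑ j, b j * μ j ^ n‖ ^ 2 with hK₀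
  have hup : ∀ M : ℕ, ∑ n ∈ Finset.range M, ‖∑ j, b j * μ j ^ n‖ ^ 2 ≤ K₀ + M * β ^ 2 := by
    intro M
    have hpt : ∀ n : ℕ, ‖∑ j, b j * μ j ^ n‖ ^ 2
        ≤ (if n < n₀ then ‖∑ j, b j * μ j ^ n‖ ^ 2 else 0) + β ^ 2 := fun n => by
      split_ifs with hn
      · linarith [sq_nonneg β]
      · have h1 := hn₀ n (not_lt.1 hn)
        have h2 := pow_le_pow_left₀ (norm_nonneg _) h1 2
        linarith
    calc ∑ n ∈ Finset.range M, ‖∑ j, b j * μ j ^ n‖ ^ 2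
        ≤ ∑ n ∈ Finset.range M, ((if n < n₀ then ‖∑ j, b j * μ j ^ n‖ ^ 2 else 0) + β ^ 2) :=
          Finset.sum_le_sum fun n _ => hpt n
      _ = (∑ n ∈ Finset.range M, if n < n₀ then ‖∑ j, b j * μ j ^ n‖ ^ 2 else 0) + M * β ^ 2 := by
          rw [Finset.sum_add_distrib]; simp
      _ ≤ K₀ + M * β ^ 2 := by
          have hK : (∑ n ∈ Finset.range M, if n < n₀ then ‖∑ j, b j * μ j ^ n‖ ^ 2 else 0) ≤ K₀ := by
            rw [← Finset.sum_filter]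
            exact Finset.sum_le_sum_of_subset_of_nonneg
              (fun n hn => by simp only [Finset.mem_filter, Finset.mem_range] at hn ⊢; exact hn.2)
              fun _ _ _ => by positivity
          linarith
  -- (6) conclude by letting `M → ∞`
  by_cases hle : ∑ j, ‖b j‖ ^ 2 ≤ β ^ 2
  · exact hle
  · exfalso
    have hlt := not_le.1 hle
    obtain ⟨M, hM⟩ := exists_nat_gt ((C₀ + K₀) / (∑ j, ‖b j‖ ^ 2 - β ^ 2))
    have h1 := (hlow M).trans (hup M)
    have h2 := (div_lt_iff₀ (sub_pos.2 hlt)).1 hM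
    rw [mul_sub] at h2
    linarith

/-- PROVED: each coefficient is bounded by `β`. [folklore] -/
theorem norm_coeff_le_of_expSum_le {ι : Type*} [Fintype ι] {μ : ι → ℂ} (hμ : Function.Injective μ)
    (hunit : ∀ j, ‖μ j‖ = 1) {b : ι → ℂ} {β : ℝ} (hβ : 0 ≤ β)
    (h : ∀ᶠ n : ℕ in atTop, ‖∑ j, b j * μ j ^ n‖ ≤ β) (j : ι) : ‖b j‖ ≤ β := by
  have h1 : ‖b j‖ ^ 2 ≤ ∑ k, ‖b k‖ ^ 2 :=
    Finset.single_le_sum (fun k _ => sq_nonneg ‖b k‖) (Finset.mem_univ j)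
  have h2 := abs_le_of_sq_le_sq (h1.trans (sum_normSq_le_of_expSum_le hμ hunit h)) hβ
  rwa [abs_norm] at h2

/-! ## §2 Cosine sums with a constant term -/

/-- PROVED: `c cos(m ω) = (c/2) (e^{iω})^m + (c/2) (e^{−iω})^m`. [folklore] -/
theorem real_cos_nat_mul_eq (c ω : ℝ) (m : ℕ) :
    ((c * Real.cos (m * ω) : ℝ) : ℂ) =
      (c : ℂ) / 2 * cexp ((ω : ℂ) * I) ^ m + (c : ℂ) / 2 * cexp (((-ω : ℝ) : ℂ) * I) ^ m := by
  have hs : ((Real.cos (m * ω) : ℝ) : ℂ) = (cexp ((m : ℂ) * ω * I) + cexp (-((m : ℂ) * ω * I))) / 2 := by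
    rw [Complex.ofReal_cos]; push_cast; simp only [Complex.cos]; ring_nf
  rw [Complex.ofReal_mul, hs, ← Complex.exp_nat_mul, ← Complex.exp_nat_mul]
  have e1 : (m : ℂ) * ((ω : ℂ) * I) = (m : ℂ) * ω * I := by ring
  have e2 : (m : ℂ) * (((-ω : ℝ) : ℂ) * I) = -((m : ℂ) * ω * I) := by push_cast; ring
  rw [e1, e2]; ring

/-- PROVED: `e^{iω} ≠ 1` for `ω ∈ (0, 2π)` (as the node equation `e^{i0} = e^{iω}`). [folklore] -/
theorem false_of_cexp_zero_eq {ω : ℝ} (hω : 0 < ω ∧ ω < 2 * Real.pi) {n : ℤ}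
    (hn : (0 : ℝ) = ω + n * (2 * Real.pi) ∨ (0 : ℝ) = -ω + n * (2 * Real.pi)) : False := by
  rcases hn with hn | hn
  · have h0 : n = 0 := int_eq_zero_of_abs_lt_two_pi (by
      rw [show (n : ℝ) * (2 * Real.pi) = -ω by linarith, abs_neg, abs_of_pos hω.1]; exact hω.2)
    subst h0; simp at hn; linarith [hω.1]
  · have h0 : n = 0 := int_eq_zero_of_abs_lt_two_pi (by
      rw [show (n : ℝ) * (2 * Real.pi) = ω by linarith, abs_of_pos hω.1]; exact hω.2)
    subst h0; simp at hn; linarith [hω.1]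

/-- **PROVED — COSINE-SUM COEFFICIENT BOUND.** For injective `ω : ι → (0, 2π)` with `ω_k + ω_l ≠ 2π` (all `k, l`):
if eventually `|c₀ + Σ_k c_k cos(m ω_k)| ≤ β` then `|c_k| ≤ 2β` for every `k` and `|c₀| ≤ β` (nodes `1`,
`e^{± i ω_k}` are pairwise distinct; coefficients `c₀`, `c_k/2`, `c_k/2`). [folklore] -/
theorem cosSum_coeff_le {ι : Type*} [Fintype ι] {ω : ι → ℝ} (hω : ∀ k, 0 < ω k ∧ ω k < 2 * Real.pi)
    (hinj : Function.Injective ω) (hsum : ∀ k l, ω k + ω l ≠ 2 * Real.pi) {c : ι → ℝ} {c₀ β : ℝ}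
    (hβ : 0 ≤ β) (hg : ∀ᶠ m : ℕ in atTop, |c₀ + ∑ k, c k * Real.cos (m * ω k)| ≤ β) :
    (∀ k, |c k| ≤ 2 * β) ∧ |c₀| ≤ β := by
  classical
  let θ : Option (ι ⊕ ι) → ℝ := fun x => x.elim 0 (Sum.elim ω fun k => -ω k)
  let μ : Option (ι ⊕ ι) → ℂ := fun x => cexp ((θ x : ℂ) * I)
  let b : Option (ι ⊕ ι) → ℂ :=
    fun x => x.elim (c₀ : ℂ) (Sum.elim (fun k => (c k : ℂ) / 2) fun k => (c k : ℂ) / 2)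
  have hunit : ∀ x, ‖μ x‖ = 1 := fun x => Complex.norm_exp_ofReal_mul_I _
  have hμ : Function.Injective μ := by
    rintro (_ | k | k) (_ | l | l) h <;> obtain ⟨n, hn⟩ := exists_int_of_cexp_mul_I_eq h <;>
      simp only [θ, Option.elim, Sum.elim_inl, Sum.elim_inr] at hn
    · rfl
    · exact (false_of_cexp_zero_eq (hω l) (Or.inl hn)).elim
    · exact (false_of_cexp_zero_eq (hω l) (Or.inr hn)).elim
    · refine (false_of_cexp_zero_eq (hω k) (n := -n) (Or.inl ?_)).elim
      push_cast; linarith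
    · have h0 : n = 0 := int_eq_zero_of_abs_lt_two_pi (by
        rw [show (n : ℝ) * (2 * Real.pi) = ω k - ω l by linarith]
        exact abs_sub_lt_iff.2 ⟨by linarith [hω k, hω l], by linarith [hω k, hω l]⟩)
      subst h0
      exact congrArg (fun i => some (Sum.inl i)) (hinj (by simpa using hn))
    · have h1 : n = 1 := int_eq_one_of_lt (by linarith [hω k, hω l]) (by linarith [hω k, hω l])
      have hn1 : (n : ℝ) = 1 := by exact_mod_cast h1
      rw [hn1] at hn
      exact absurd (by linarith : ω k + ω l = 2 * Real.pi) (hsum k l)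
    · refine (false_of_cexp_zero_eq (hω k) (n := -n) (Or.inr ?_)).elim
      push_cast; linarith
    · have h1 : -n = 1 :=
        int_eq_one_of_lt (n := -n) (by push_cast; linarith [hω k, hω l]) (by push_cast; linarith [hω k, hω l])
      have hn1 : (n : ℝ) = -1 := by
        have hc : ((-n : ℤ) : ℝ) = 1 := by exact_mod_cast h1
        push_cast at hc
        linarith
      rw [hn1] at hn
      exact absurd (by linarith : ω k + ω l = 2 * Real.pi) (hsum k l)
    · have h0 : n = 0 := int_eq_zero_of_abs_lt_two_pi (by
        rw [show (n : ℝ) * (2 * Real.pi) = ω l - ω k by linarith]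
        exact abs_sub_lt_iff.2 ⟨by linarith [hω k, hω l], by linarith [hω k, hω l]⟩)
      subst h0
      exact congrArg (fun i => some (Sum.inr i)) (hinj (by simp at hn; linarith))
  have hfun : ∀ m : ℕ, (((c₀ + ∑ k, c k * Real.cos (m * ω k) : ℝ)) : ℂ) = ∑ x, b x * μ x ^ m := by
    intro m
    rw [Complex.ofReal_add, Complex.ofReal_sum, Fintype.sum_option, Fintype.sum_sum_type]
    have h0 : b none * μ none ^ m = c₀ := by simp [b, μ, θ]
    rw [h0]
    simp only [b, μ, θ, Option.elim, Sum.elim_inl, Sum.elim_inr]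
    rw [← Finset.sum_add_distrib]
    exact congrArg _ (Finset.sum_congr rfl fun k _ => real_cos_nat_mul_eq (c k) (ω k) m)
  have hgC : ∀ᶠ m : ℕ in atTop, ‖∑ x, b x * μ x ^ m‖ ≤ β :=
    hg.mono fun m hm => by rw [← hfun m, Complex.norm_real, Real.norm_eq_abs]; exact hm
  have hle := norm_coeff_le_of_expSum_le hμ hunit hβ hgC
  refine ⟨fun k => ?_, ?_⟩
  · have := hle (some (Sum.inl k))
    simp only [b, Option.elim, Sum.elim_inl, norm_div, Complex.norm_real, Real.norm_eq_abs,
      Complex.norm_ofNat] at this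
    linarith
  · have := hle none
    simpa [b] using this

end Summit.RiemannHypothesis.RiemannHypothesis.Theorems.PfPersistence
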